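import Mathlib

/-!
# Square-difference-free digit sets in quadratic orders `ℤ[√d]`
(wall-breaker k8 for `stub_tangencySets`, crux `LevelOneGL2Designs`, stmt-MatrixMultiplication-14080;
input of the quadratic-order parabola lift `…QuadraticLift.lean`)

Ruzsa's digit construction (Period. Math. Hungar. 15 (1984), §2) of square-difference-free sets of
integers runs verbatim in `ℤ√d` with a rational integer base `b` that is *square-free in `ℤ√d`*
(`b ∣ z² ⇒ b ∣ z`) and a residue set `R ⊆ [0,b)²` no two of whose elements differ by a square modulo `b`:

* `sqDiffFree_digitStep` — if `K ⊆ [0,W)²` is square-difference-free in `ℤ√d` (`k - k' = z² ⇒ z = 0`)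
  then so is `{r + b(e + b k) : r ∈ R, e ∈ [0,b)², k ∈ K} ⊆ [0, b²W)²`, with `|R|·b²·|K|` elements;
* `exists_sqDiffFree_digits` — iterating: `|K_t| = (|R| b²)^t` inside `[0, b^{2t})²`.

When `b = ℓ` is a prime INERT in `ℤ[√d]` the residue ring is the field `𝔽_{ℓ²}`, and if moreover
`1 + √d` is a non-square mod `ℓ` (equivalently `N(1+√d) = 1 - d` is a non-residue mod `ℓ`) the diagonal
`R = {(ρ,ρ) : 0 ≤ ρ < ℓ}` qualifies (it is `(1+√d)·𝔽_ℓ`, a Paley coclique of `𝔽_{ℓ²}` of the maximal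
size `ℓ = √(ℓ²)`), giving `|K_t| = ℓ^{3t} = (ℓ^{4t})^{3/4}`: EXPONENT `3/4`, versus `0.7334` for rational
digits (Lewko 2015).  Both hypotheses reduce to one decidable kernel statement mod `ℓ`
(`exists_sqDiffFree_diag`), discharged by `decide` for `(d,ℓ) = (2,3), (-2,5), (-1,3)`:

* `exists_sqDiffFree_sqrtTwo`    — `K ⊆ ℤ[√2]`,  `|K| = 27^t`  inside `[0,9^t)²`;
* `exists_sqDiffFree_sqrtNegTwo` — `K ⊆ ℤ[√-2]`, `|K| = 125^t` inside `[0,25^t)²`;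
* `exists_sqDiffFree_sqrtNegOne` — `K ⊆ ℤ[√-1]`, `|K| = 27^t`  inside `[0,9^t)²` (the Gaussian case;
  wall-breaker k2's `ParabolaLift.exists_gaussSqDiffFree` is the same set in `ℕ × ℕ` encoding).

Exponent `3/4` is optimal for this method: for a base whose residue fields all have square order the
square-difference Cayley graph of `ℤ√d/(b)` has a clique of size `√N(b)` (product of subfields), so by
clique·coclique ≤ order every admissible `R` has `|R| ≤ √N(b) = b` (see AXIS.md of the seat; checked
exhaustively for `ℤ[√2]/(15) ≅ 𝔽₉ × 𝔽₂₅`: max `|R| = 15`).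
References: Ruzsa 1984 [bib: Ruzsa1984DifferenceSetsWithoutSquares]; M. Lewko, *An improved lower
bound related to the Furstenberg–Sárközy theorem*, Electron. J. Combin. 22 (2015).  Elementary; no
definitions are introduced.
-/

-- justification: the summit/problem path `MatrixMultiplication.MatrixMultiplication` is fixed by the
-- tree layout (D-0017), so the namespace necessarily repeats a component.
set_option linter.dupNamespace false

open Finset

namespace Summit.MatrixMultiplication.MatrixMultiplication.Theorems.LevelOneGL2Designs.QuadraticLift

variable {d : ℤ}

/-- Positional digits are unique: `A + b·B = A' + b·B'` with `A, A' ∈ [0,b)` forces `A = A'` and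
`B = B'`. [elementary] -/
theorem digit_inj {b A A' B B' : ℤ} (hb : 0 < b) (hA : 0 ≤ A) (hAb : A < b) (hA' : 0 ≤ A')
    (hA'b : A' < b) (h : A + b * B = A' + b * B') : A = A' ∧ B = B' := by
  have h1 : (A + b * B) % b = A := by
    rw [Int.add_mul_emod_self_left]; exact Int.emod_eq_of_lt hA hAb
  have h1' : (A' + b * B') % b = A' := by
    rw [Int.add_mul_emod_self_left]; exact Int.emod_eq_of_lt hA' hA'b
  have hAA : A = A' := by rw [← h1, ← h1', h]
  refine ⟨hAA, ?_⟩
  subst hAA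
  have : b * B = b * B' := by linarith
  exact mul_left_cancel₀ hb.ne' this

/-- In a non-square order `ℤ√d`, `z² = 0` forces `z = 0` (the norm form is anisotropic). [elementary] -/
theorem eq_zero_of_mul_self_eq_zero (hd : ∀ n : ℤ, d ≠ n * n) {z : ℤ√d} (h : z * z = 0) : z = 0 := by
  have h1 : z.norm * z.norm = 0 := by rw [← Zsqrtd.norm_mul, h, Zsqrtd.norm_zero]
  exact (Zsqrtd.norm_eq_zero hd z).mp (mul_self_eq_zero.mp h1)

/-- The box `[0,m)²` of `ℤ√d`, `m²` elements (digit ranges). [elementary] -/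
theorem exists_digitBox (d : ℤ) (m : ℕ) : ∃ D : Finset (ℤ√d), D.card = m * m ∧
    ∀ x ∈ D, 0 ≤ x.re ∧ x.re < m ∧ 0 ≤ x.im ∧ x.im < m := by
  classical
  refine ⟨(range m ×ˢ range m).image fun ab => (⟨ab.1, ab.2⟩ : ℤ√d), ?_, ?_⟩
  · rw [card_image_of_injective, card_product, card_range]
    rintro ⟨a, b⟩ ⟨a', b'⟩ h
    simp only [Zsqrtd.mk.injEq, Nat.cast_inj] at h
    rw [h.1, h.2]
  · intro x hx
    simp only [mem_image, mem_product, mem_range, Prod.exists] at hx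
    obtain ⟨a, b, ⟨ha, hb⟩, rfl⟩ := hx
    exact ⟨by simp, by simpa using ha, by simp, by simpa using hb⟩

/-- **One digit step (Ruzsa 1984 in `ℤ√d`).**  Base `b` square-free in `ℤ√d`, residue set
`R ⊆ [0,b)²` with no two elements differing by a square mod `b`, and `K ⊆ [0,W)²` square-difference-free
⟹ `{r + b(e + b k)} ⊆ [0,b²W)²` is square-difference-free with `|R|·b²·|K|` elements.  Proof: if
`n - n' = z²` then mod `b` the `R`-digits agree, so `b ∣ z²`, so `b ∣ z`, so `b² ∣ z²` and the middle
digits agree, and `(z/b)² = k - k'`. [elementary] -/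
theorem sqDiffFree_digitStep (b : ℕ) (hb : 0 < b)
    (hbsq : ∀ z : ℤ√d, ((b : ℤ) : ℤ√d) ∣ z * z → ((b : ℤ) : ℤ√d) ∣ z)
    (R : Finset (ℤ√d)) (hRbox : ∀ r ∈ R, 0 ≤ r.re ∧ r.re < b ∧ 0 ≤ r.im ∧ r.im < b)
    (hR : ∀ r ∈ R, ∀ r' ∈ R, ∀ z : ℤ√d, ((b : ℤ) : ℤ√d) ∣ z * z - (r - r') → r = r')
    (W : ℕ) (K : Finset (ℤ√d)) (hKbox : ∀ k ∈ K, 0 ≤ k.re ∧ k.re < W ∧ 0 ≤ k.im ∧ k.im < W)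
    (hK : ∀ k ∈ K, ∀ k' ∈ K, ∀ z : ℤ√d, k - k' = z * z → z = 0) :
    ∃ K' : Finset (ℤ√d), K'.card = R.card * (b * b) * K.card ∧
      (∀ k ∈ K', 0 ≤ k.re ∧ k.re < b * b * W ∧ 0 ≤ k.im ∧ k.im < b * b * W) ∧
      ∀ k ∈ K', ∀ k' ∈ K', ∀ z : ℤ√d, k - k' = z * z → z = 0 := by
  classical
  obtain ⟨D, hDcard, hD⟩ := exists_digitBox d b
  have hb' : (0 : ℤ) < b := by exact_mod_cast hb
  set β : ℤ√d := ((b : ℤ) : ℤ√d) with hβ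
  set f : ℤ√d × ℤ√d × ℤ√d → ℤ√d := fun x => x.1 + β * (x.2.1 + β * x.2.2) with hf
  have hre : ∀ x : ℤ√d × ℤ√d × ℤ√d, (f x).re = x.1.re + b * (x.2.1.re + b * x.2.2.re) := by
    intro x; simp only [hf, hβ, Zsqrtd.re_add, Zsqrtd.re_smul]
  have him : ∀ x : ℤ√d × ℤ√d × ℤ√d, (f x).im = x.1.im + b * (x.2.1.im + b * x.2.2.im) := by
    intro x; simp only [hf, hβ, Zsqrtd.im_add, Zsqrtd.im_smul]
  have hinj : Set.InjOn f ↑(R ×ˢ (D ×ˢ K)) := by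
    rintro ⟨r, e, k⟩ hx ⟨r', e', k'⟩ hx' h
    simp only [coe_product, Set.mem_prod, mem_coe] at hx hx'
    obtain ⟨hr, he, -⟩ := hx
    obtain ⟨hr', he', -⟩ := hx'
    have h1 := congrArg Zsqrtd.re h
    have h2 := congrArg Zsqrtd.im h
    rw [hre, hre] at h1
    rw [him, him] at h2
    obtain ⟨hrr, h1'⟩ := digit_inj hb' (hRbox r hr).1 (hRbox r hr).2.1 (hRbox r' hr').1
      (hRbox r' hr').2.1 h1
    obtain ⟨hee, hkk⟩ := digit_inj hb' (hD e he).1 (hD e he).2.1 (hD e' he').1 (hD e' he').2.1 h1'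
    obtain ⟨hrr2, h2'⟩ := digit_inj hb' (hRbox r hr).2.2.1 (hRbox r hr).2.2.2 (hRbox r' hr').2.2.1
      (hRbox r' hr').2.2.2 h2
    obtain ⟨hee2, hkk2⟩ := digit_inj hb' (hD e he).2.2.1 (hD e he).2.2.2 (hD e' he').2.2.1
      (hD e' he').2.2.2 h2'
    simp only [Prod.mk.injEq]
    exact ⟨Zsqrtd.ext hrr hrr2, Zsqrtd.ext hee hee2, Zsqrtd.ext hkk hkk2⟩
  refine ⟨(R ×ˢ (D ×ˢ K)).image f, ?_, ?_, ?_⟩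
  · rw [card_image_of_injOn hinj, card_product, card_product, hDcard]
    ring
  · intro n hn
    rw [mem_image] at hn
    obtain ⟨⟨r, e, k⟩, hx, rfl⟩ := hn
    simp only [mem_product] at hx
    obtain ⟨hr, he, hk⟩ := hx
    obtain ⟨hr1, hr2, hr3, hr4⟩ := hRbox r hr
    obtain ⟨he1, he2, he3, he4⟩ := hD e he
    obtain ⟨hk1, hk2, hk3, hk4⟩ := hKbox k hk
    rw [hre, him]
    refine ⟨by positivity, ?_, by positivity, ?_⟩
    · have h1 : e.re + b * k.re ≤ b * W - 1 := by nlinarith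
      nlinarith
    · have h1 : e.im + b * k.im ≤ b * W - 1 := by nlinarith
      nlinarith
  · intro n hn n' hn' z hz
    rw [mem_image] at hn hn'
    obtain ⟨⟨r, e, k⟩, hx, rfl⟩ := hn
    obtain ⟨⟨r', e', k'⟩, hx', rfl⟩ := hn'
    simp only [mem_product] at hx hx'
    obtain ⟨hr, he, hk⟩ := hx
    obtain ⟨hr', he', hk'⟩ := hx'
    simp only [hf] at hz
    -- `z² - (r - r') = b · (…)`
    have hz' : z * z - (r - r') = β * ((e - e') + β * (k - k')) := by rw [← hz]; ring
    have hrr : r = r' := hR r hr r' hr' z ⟨_, hz'⟩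
    subst hrr
    have hzz : z * z = β * ((e - e') + β * (k - k')) := by rw [← hz', sub_self, sub_zero]
    obtain ⟨w, rfl⟩ := hbsq z ⟨_, hzz⟩
    -- cancel one factor `b`
    have h1 : β * (w * (β * w)) = β * ((e - e') + β * (k - k')) := by rw [← hzz]; ring
    have h2 : w * (β * w) = (e - e') + β * (k - k') :=
      Zsqrtd.eq_of_smul_eq_smul_left hb'.ne' h1
    -- the middle digits agree
    have h3 : β ∣ e - e' := ⟨w * w - (k - k'), by linear_combination (-1 : ℤ√d) * h2⟩
    rw [hβ, Zsqrtd.intCast_dvd] at h3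
    obtain ⟨he1, he2, he3, he4⟩ := hD e he
    obtain ⟨he1', he2', he3', he4'⟩ := hD e' he'
    have h4 : (e - e').re = 0 := by
      refine Int.eq_zero_of_abs_lt_dvd h3.1 ?_
      rw [Zsqrtd.re_sub, abs_lt]; constructor <;> linarith
    have h5 : (e - e').im = 0 := by
      refine Int.eq_zero_of_abs_lt_dvd h3.2 ?_
      rw [Zsqrtd.im_sub, abs_lt]; constructor <;> linarith
    have hee : e - e' = 0 := Zsqrtd.ext h4 h5
    rw [hee, zero_add] at h2
    -- cancel the second factor `b` and conclude with the hypothesis on `K`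
    have h6 : β * (w * w) = β * (k - k') := by rw [← h2]; ring
    have h7 : w * w = k - k' := Zsqrtd.eq_of_smul_eq_smul_left hb'.ne' h6
    have hw : w = 0 := hK k hk k' hk' w h7.symm
    rw [hw, mul_zero]

/-- **Iterated digits.**  With `b`, `R` as in `sqDiffFree_digitStep` (and `d` a non-square), for every
`t` there is a square-difference-free `K ⊆ [0, b^{2t})²` of `ℤ√d` with `(|R|·b²)^t` elements. [elementary] -/
theorem exists_sqDiffFree_digits (hd : ∀ n : ℤ, d ≠ n * n) (b : ℕ) (hb : 0 < b)
    (hbsq : ∀ z : ℤ√d, ((b : ℤ) : ℤ√d) ∣ z * z → ((b : ℤ) : ℤ√d) ∣ z)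
    (R : Finset (ℤ√d)) (hRbox : ∀ r ∈ R, 0 ≤ r.re ∧ r.re < b ∧ 0 ≤ r.im ∧ r.im < b)
    (hR : ∀ r ∈ R, ∀ r' ∈ R, ∀ z : ℤ√d, ((b : ℤ) : ℤ√d) ∣ z * z - (r - r') → r = r') (t : ℕ) :
    ∃ K : Finset (ℤ√d), K.card = (R.card * (b * b)) ^ t ∧
      (∀ k ∈ K, 0 ≤ k.re ∧ k.re < (b * b) ^ t ∧ 0 ≤ k.im ∧ k.im < (b * b) ^ t) ∧
      ∀ k ∈ K, ∀ k' ∈ K, ∀ z : ℤ√d, k - k' = z * z → z = 0 := by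
  induction t with
  | zero =>
      refine ⟨{0}, by simp, fun k hk => ?_, fun k hk k' hk' z hz => ?_⟩
      · rw [mem_singleton] at hk
        subst hk
        simp
      · rw [mem_singleton] at hk hk'
        subst hk hk'
        rw [sub_self] at hz
        exact eq_zero_of_mul_self_eq_zero hd hz.symm
  | succ t ih =>
      obtain ⟨K, hKcard, hKbox, hK⟩ := ih
      obtain ⟨K', hK'card, hK'box, hK'⟩ := sqDiffFree_digitStep b hb hbsq R hRbox hR ((b * b) ^ t) K
        (fun k hk => by exact_mod_cast hKbox k hk) hK
      refine ⟨K', ?_, fun k hk => ?_, hK'⟩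
      · rw [hK'card, hKcard]; ring
      · obtain ⟨h1, h2, h3, h4⟩ := hK'box k hk
        refine ⟨h1, ?_, h3, ?_⟩
        · calc k.re < b * b * ((b * b) ^ t : ℕ) := h2
            _ = (b * b : ℤ) ^ (t + 1) := by push_cast; ring
        · calc k.im < b * b * ((b * b) ^ t : ℕ) := h4
            _ = (b * b : ℤ) ^ (t + 1) := by push_cast; ring

/-- **Diagonal residue set.**  If the only solution of `u² + d v² ≡ 2uv (mod b)` is `u ≡ v ≡ 0`
(i.e. `b` is inert in `ℤ[√d]` and `(1+√d)·ρ` is a non-square mod `b` for `ρ ≢ 0`), then `b` is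
square-free in `ℤ√d` and the diagonal `R = {(ρ,ρ) : 0 ≤ ρ < b}` has no two elements differing by a
square mod `b`; hence square-difference-free `K ⊆ [0,b^{2t})²` with `|K| = b^{3t}` exist for all `t`:
exponent `3/4`. [elementary] -/
theorem exists_sqDiffFree_diag (hd : ∀ n : ℤ, d ≠ n * n) (b : ℕ) (hb : 0 < b)
    (hdiag : ∀ u v : ℤ, (b : ℤ) ∣ u * u + d * v * v - (u * v + v * u) → (b : ℤ) ∣ u ∧ (b : ℤ) ∣ v)
    (t : ℕ) :
    ∃ K : Finset (ℤ√d), K.card = (b * (b * b)) ^ t ∧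
      (∀ k ∈ K, 0 ≤ k.re ∧ k.re < (b * b) ^ t ∧ 0 ≤ k.im ∧ k.im < (b * b) ^ t) ∧
      ∀ k ∈ K, ∀ k' ∈ K, ∀ z : ℤ√d, k - k' = z * z → z = 0 := by
  classical
  -- square-freeness of `b`
  have hbsq : ∀ z : ℤ√d, ((b : ℤ) : ℤ√d) ∣ z * z → ((b : ℤ) : ℤ√d) ∣ z := by
    intro z hz
    rw [Zsqrtd.intCast_dvd] at hz ⊢
    rw [Zsqrtd.re_mul, Zsqrtd.im_mul] at hz
    exact hdiag z.re z.im (dvd_sub hz.1 hz.2)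
  -- the diagonal residue set
  set R : Finset (ℤ√d) := (range b).image fun ρ : ℕ => (⟨(ρ : ℤ), (ρ : ℤ)⟩ : ℤ√d) with hRdef
  have hRinj : Function.Injective fun ρ : ℕ => (⟨(ρ : ℤ), (ρ : ℤ)⟩ : ℤ√d) := by
    intro ρ ρ' h
    simp only [Zsqrtd.mk.injEq, Nat.cast_inj] at h
    exact h.1
  have hRcard : R.card = b := by rw [hRdef, card_image_of_injective _ hRinj, card_range]
  have hRbox : ∀ r ∈ R, 0 ≤ r.re ∧ r.re < b ∧ 0 ≤ r.im ∧ r.im < b := by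
    intro r hr
    rw [hRdef, mem_image] at hr
    obtain ⟨ρ, hρ, rfl⟩ := hr
    rw [mem_range] at hρ
    exact ⟨by simp, by simpa using hρ, by simp, by simpa using hρ⟩
  have hR : ∀ r ∈ R, ∀ r' ∈ R, ∀ z : ℤ√d, ((b : ℤ) : ℤ√d) ∣ z * z - (r - r') → r = r' := by
    intro r hr r' hr' z hz
    rw [hRdef, mem_image] at hr hr'
    obtain ⟨ρ, hρ, rfl⟩ := hr
    obtain ⟨ρ', hρ', rfl⟩ := hr'
    rw [mem_range] at hρ hρ'
    rw [Zsqrtd.intCast_dvd] at hz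
    simp only [Zsqrtd.re_sub, Zsqrtd.im_sub, Zsqrtd.re_mul, Zsqrtd.im_mul] at hz
    obtain ⟨h1, h2⟩ := hz
    -- subtracting the two coordinates kills the digit difference
    have h3 : (b : ℤ) ∣ z.re ∧ (b : ℤ) ∣ z.im := by
      refine hdiag z.re z.im ?_
      have key : z.re * z.re + d * z.im * z.im - (z.re * z.im + z.im * z.re) =
          (z.re * z.re + d * z.im * z.im - (ρ - ρ')) - (z.re * z.im + z.im * z.re - (ρ - ρ')) := by
        ring
      rw [key]
      exact dvd_sub h1 h2
    have h4 : (b : ℤ) ∣ z.re * z.re + d * z.im * z.im :=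
      dvd_add (dvd_mul_of_dvd_left h3.1 _) (dvd_mul_of_dvd_right h3.2 _)
    have h5 : (b : ℤ) ∣ (ρ : ℤ) - ρ' := by
      have key : (ρ : ℤ) - ρ' =
          (z.re * z.re + d * z.im * z.im) - (z.re * z.re + d * z.im * z.im - (ρ - ρ')) := by ring
      rw [key]
      exact dvd_sub h4 h1
    have h6 : (ρ : ℤ) - ρ' = 0 := by
      refine Int.eq_zero_of_abs_lt_dvd h5 ?_
      rw [abs_lt]; constructor <;> omega
    have h7 : ρ = ρ' := by omega
    rw [h7]
  obtain ⟨K, hKcard, hKbox, hK⟩ := exists_sqDiffFree_digits hd b hb hbsq R hRbox hR t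
  exact ⟨K, by rw [hKcard, hRcard], hKbox, hK⟩

/-- `2` is not a square in `ℤ`. [elementary] -/
theorem two_ne_mul_self (n : ℤ) : (2 : ℤ) ≠ n * n := by
  intro h
  rcases le_or_gt 2 |n| with h2 | h2
  · have : 4 ≤ |n| * |n| := by nlinarith
    rw [abs_mul_abs_self] at this
    omega
  · have : |n| * |n| ≤ 1 := by
      have h0 := abs_nonneg n
      nlinarith
    rw [abs_mul_abs_self] at this
    omega

/-- A negative integer is not a square in `ℤ`. [elementary] -/
theorem neg_ne_mul_self {d : ℤ} (hd : d < 0) (n : ℤ) : d ≠ n * n := by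
  intro h; nlinarith [mul_self_nonneg n]

/-- **Digits in `ℤ[√2]`, base `3`** (`3` is inert, `N(1+√2) = -1` is a non-residue mod `3`):
square-difference-free `K ⊆ [0,9^t)²` with `|K| = 27^t`. [elementary] -/
theorem exists_sqDiffFree_sqrtTwo (t : ℕ) :
    ∃ K : Finset (ℤ√2), K.card = 27 ^ t ∧
      (∀ k ∈ K, 0 ≤ k.re ∧ k.re < 9 ^ t ∧ 0 ≤ k.im ∧ k.im < 9 ^ t) ∧
      ∀ k ∈ K, ∀ k' ∈ K, ∀ z : ℤ√2, k - k' = z * z → z = 0 := by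
  have key : ∀ u v : ZMod 3, u * u + 2 * v * v - (u * v + v * u) = 0 → u = 0 ∧ v = 0 := by decide
  have hdiag : ∀ u v : ℤ, (((3 : ℕ) : ℤ)) ∣ u * u + 2 * v * v - (u * v + v * u) →
      ((3 : ℕ) : ℤ) ∣ u ∧ ((3 : ℕ) : ℤ) ∣ v := by
    intro u v h
    have h' := (ZMod.intCast_zmod_eq_zero_iff_dvd _ 3).mpr (by exact_mod_cast h)
    push_cast at h'
    obtain ⟨hu, hv⟩ := key _ _ h'
    exact ⟨by exact_mod_cast (ZMod.intCast_zmod_eq_zero_iff_dvd u 3).mp hu,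
      by exact_mod_cast (ZMod.intCast_zmod_eq_zero_iff_dvd v 3).mp hv⟩
  obtain ⟨K, h1, h2, h3⟩ := exists_sqDiffFree_diag two_ne_mul_self 3 (by norm_num) hdiag t
  refine ⟨K, by simpa using h1, fun k hk => ?_, h3⟩
  have := h2 k hk
  norm_num at this
  exact this

/-- **Digits in `ℤ[√-2]`, base `5`** (`5` is inert, `N(1+√-2) = 3` is a non-residue mod `5`):
square-difference-free `K ⊆ [0,25^t)²` with `|K| = 125^t`. [elementary] -/
theorem exists_sqDiffFree_sqrtNegTwo (t : ℕ) :
    ∃ K : Finset (ℤ√(-2)), K.card = 125 ^ t ∧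
      (∀ k ∈ K, 0 ≤ k.re ∧ k.re < 25 ^ t ∧ 0 ≤ k.im ∧ k.im < 25 ^ t) ∧
      ∀ k ∈ K, ∀ k' ∈ K, ∀ z : ℤ√(-2), k - k' = z * z → z = 0 := by
  have key : ∀ u v : ZMod 5, u * u + (-2) * v * v - (u * v + v * u) = 0 → u = 0 ∧ v = 0 := by
    decide
  have hdiag : ∀ u v : ℤ, (((5 : ℕ) : ℤ)) ∣ u * u + (-2) * v * v - (u * v + v * u) →
      ((5 : ℕ) : ℤ) ∣ u ∧ ((5 : ℕ) : ℤ) ∣ v := by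
    intro u v h
    have h' := (ZMod.intCast_zmod_eq_zero_iff_dvd _ 5).mpr (by exact_mod_cast h)
    push_cast at h'
    obtain ⟨hu, hv⟩ := key _ _ h'
    exact ⟨by exact_mod_cast (ZMod.intCast_zmod_eq_zero_iff_dvd u 5).mp hu,
      by exact_mod_cast (ZMod.intCast_zmod_eq_zero_iff_dvd v 5).mp hv⟩
  obtain ⟨K, h1, h2, h3⟩ :=
    exists_sqDiffFree_diag (neg_ne_mul_self (by norm_num)) 5 (by norm_num) hdiag t
  refine ⟨K, by simpa using h1, fun k hk => ?_, h3⟩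
  have := h2 k hk
  norm_num at this
  exact this

/-- **Digits in `ℤ[√-1]`, base `3`** (the Gaussian case: `3` is inert, `N(1+i) = 2` is a non-residue
mod `3`): square-difference-free `K ⊆ [0,9^t)²` with `|K| = 27^t`.  (Same set as wall-breaker k2's
`ParabolaLift.exists_gaussSqDiffFree`, here as a subset of `ℤ√(-1)`.) [elementary] -/
theorem exists_sqDiffFree_sqrtNegOne (t : ℕ) :
    ∃ K : Finset (ℤ√(-1)), K.card = 27 ^ t ∧
      (∀ k ∈ K, 0 ≤ k.re ∧ k.re < 9 ^ t ∧ 0 ≤ k.im ∧ k.im < 9 ^ t) ∧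
      ∀ k ∈ K, ∀ k' ∈ K, ∀ z : ℤ√(-1), k - k' = z * z → z = 0 := by
  have key : ∀ u v : ZMod 3, u * u + (-1) * v * v - (u * v + v * u) = 0 → u = 0 ∧ v = 0 := by
    decide
  have hdiag : ∀ u v : ℤ, (((3 : ℕ) : ℤ)) ∣ u * u + (-1) * v * v - (u * v + v * u) →
      ((3 : ℕ) : ℤ) ∣ u ∧ ((3 : ℕ) : ℤ) ∣ v := by
    intro u v h
    have h' := (ZMod.intCast_zmod_eq_zero_iff_dvd _ 3).mpr (by exact_mod_cast h)
    push_cast at h'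
    obtain ⟨hu, hv⟩ := key _ _ h'
    exact ⟨by exact_mod_cast (ZMod.intCast_zmod_eq_zero_iff_dvd u 3).mp hu,
      by exact_mod_cast (ZMod.intCast_zmod_eq_zero_iff_dvd v 3).mp hv⟩
  obtain ⟨K, h1, h2, h3⟩ :=
    exists_sqDiffFree_diag (neg_ne_mul_self (by norm_num)) 3 (by norm_num) hdiag t
  refine ⟨K, by simpa using h1, fun k hk => ?_, h3⟩
  have := h2 k hk
  norm_num at this
  exact this

end Summit.MatrixMultiplication.MatrixMultiplication.Theorems.LevelOneGL2Designs.QuadraticLift
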